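import Literature.MathematicalPhysics.QuantumFieldTheory.Balaban1983to89.B9Thm31GpAtKnitLetterOfCubeData
import Literature.MathematicalPhysics.QuantumFieldTheory.Balaban1983to89.B9Thm31GradGpAtKnitLetterOfCubeData
import Literature.MathematicalPhysics.QuantumFieldTheory.Balaban1983to89.B9Thm32CinvAtKnitLetterOfCubeDataThmD
import Literature.MathematicalPhysics.QuantumFieldTheory.Balaban1983to89.B8Thm2TorusKnitEstimatesOfMajorants

/-!
# `Balaban1983to89.B9KnitMajorantsOfCubeData` — [B9] THEOREMS 3.1 (3.42)₁,₂ + 3.2 (3.48) AT PRINT's KNIT LETTER, PACKAGED AS THE [B8] THM 2 TORUS ASSEMBLER's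
# `KnitMajorants` FOR EVERY MEMBER ABOVE ONE THRESHOLD AND EVERY `U(N)`-VALUED BACKGROUND OF THE CLASS (52) CARRYING PER-CUBE (3.35) DATA — ALL THREE LETTERS
# THEOREM-FED FROM ONE DATUM FAMILY, ONE COMMON RATE (sub-row G-B9-LETTERS × G-B8-T2S; FILE 15 of seat p33: FILES 12 ∕ 13 ∕ 14 bundled at `min` of their rates,
# plus the member's [4] §2 geometry from the tree, in `B8Thm2TorusKnitEstimatesOfMajorants.KnitMajorants` — the input of t2s-1's `thm2TorusAt_specialUnitary_ofMajorants`)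

T. Bałaban, *Propagators for lattice gauge theories in a background field*, Commun. Math. Phys. **99** (1985) 389–434
[`Balaban1985BackgroundPropagators`, "B9"]; [4] = T. Bałaban, *Propagators and renormalization transformations for lattice gauge theories. II*, Commun.
Math. Phys. **96** (1984) 223–250 [`Balaban1984PropagatorsII`]; [2] = T. Bałaban, *Regularity and decay of lattice Green's functions*, Commun. Math. Phys.
**89** (1983) 571–597 [`Balaban1983RegularityDecay`]; T. Bałaban, *Averaging operations for lattice gauge theories*, Commun. Math. Phys. **98** (1985) 17–51
[`Balaban1985Averaging`, "B7"] for the class (52); T. Bałaban, *Spaces of regular gauge field configurations on a lattice and gauge fixing conditions*, Commun.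
Math. Phys. **99** (1985) 75–102 [`Balaban1985RegularSpaces`, "B8"] for the consumer (Thm 2 p. 83, (1.91)–(1.98) pp. 91–92).

statement-level skeleton of published theorems with citation tags; proofs where landed; nothing here is a claim about the
Yang–Mills mass gap

THE PRINTED LOCUS (verbatim, held `paper:balaban1985-cmp99-background-propagators`, journal page = PDF page + 388).  Thm 3.1 (3.42) p. 397 («|G′(U)(x,x′)|,
|η⁻¹∇_U G′(U)(x,x′)| … ≦ … e^{−δd(x,x′)}»); Thm 3.2 (3.48) p. 398; (3.19) p. 393 (the knit transporters of print's averaging); p. 409 l. 1–5, Thm 3.7 pp. 409–410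
(«for M sufficiently large»), Cor. 3.6 p. 408, Thm 3.9 p. 413 («This theorem implies Theorem 3.2»), p. 412 l. 1–9 (Theorem D), Thm 3.11 p. 416; [4] Lemma 2.1
(2.60)–(2.63) p. 234 + (2.59) p. 233 («for RM satisfying (2.59)»), (2.54) p. 233, (2.50)–(2.52) p. 232; [B8] (1.91)–(1.98) pp. 91–92 (where the three estimates are
consumed on the torus); [B7] (52)–(53) pp. 26–27.

WHY THIS FILE.  The [B8] Thm 2 torus assembler of seat t2s-1 consumes, per member `n` and background `U`, the package
`B8Thm2TorusKnitEstimatesOfMajorants.KnitMajorants i U b ιB Rr Hp d₁ δ₀ δ βₓ ρ A A₁ K c s` — the (3.42)₁ site majorant `hGm` of `η²G′(U; parKnitY)`, the (3.42)₂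
site majorants `hDG μ` of `η⁻¹∇_μ·η²G′(U; parKnitY)`, the (3.48) block majorant `hC` of `s·(Q′G′²Q′*)⁻¹(U; parKnitY)` at ONE rate `δ` with UNIFORM amplitudes
`A, A₁, K`, together with the member's [4] §2 geometry ((2.54), `d ≥ 0`, (2.61) at the resummation pair `(δ₀, βₓ)`, the row sum at the final rate `ρ`) and the unit
`η_S⁴·s = 1` (`knitEstimates_of_majorants`, `thm2TorusAt_specialUnitary_ofMajorants`).  Seat p33's FILE 12 `B9Thm31GpAtKnitLetterOfCubeData` (hGm, rate `δ_G∕2`),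
FILE 13 `B9Thm31GradGpAtKnitLetterOfCubeData` (hDG, rate `δ_G∕2`) and FILE 14 `B9Thm32CinvAtKnitLetterOfCubeDataThmD` (hC, rate `r∕2⁸`, Theorem D discharged by
p21's D6) prove the three letters for every member above one threshold from ONE per-cube (3.35) datum family + the class (52), under ONE binder list.  THIS FILE
bundles them: §1 ★★★ `knitLetters_of_cubeData_unitary` — the three letters under ONE existential header (common rate `δ = min(δ₁₂, δ₁₃, δ₁₄)` by
`hasMajorant_rate_mono`, amplitudes `K_G, K_D, K_C`, thresholds `max`, sizes `min`) and FILES 12–14's common binder list VERBATIM; §2 ★★★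
`knitMajorants_of_cubeData_unitary` — for every resummation triple `(δ₀, βₓ, ρ)` with `βₓδ₀ > 0`, `ρ > 0` (the consumer's `KnitConstants` choice, made AFTER `δ`:
`ρ + 2βₓδ₀ ≤ δ`), above one further member threshold, the INHABITED `KnitMajorants i U b ιB (Rr i) (Hp i) (exp261 geo9K δ₀ βₓ) δ₀ δ βₓ ρ K_G K_D K_C
(c₁(exp261 geo9K ρ 1, ρ, 1)) (η_S²η_S²)⁻¹` — the geometry from the tree (r06-lineage `rowSum261_geo9K` → `ineq261_exp261_of_rowSum261` at the family's door
exponents BY CHOICE, `geo9K_dist_triangle` ∕ `geo9K_dist_nonneg'`, as in t2s-1's A10 `B8Thm2TorusKnitCubeGeometry`).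

HONEST SCOPE / NOT CLAIMED.  Composition of landed theorems with threshold ∕ rate bookkeeping; NO estimate of [B9] ∕ [B8] ∕ [4] is proved here.  DISPLAYED
(FILES 12–14's list, nothing added but the consumer's resummation triple): the per-cube (3.35) data family in p33's unpacked form (bi-contractive gauges `u_□`,
potentials `A_□` on torus sets `Q_□ ⊇ NearC_□(35S_j∕8 + 1)` — which class cube supplies them for the assembler's periodic `U₀ ∈ 𝔄_n(T_η, α₀)` is FILE 4's open
question (Q1) ∕ the M5.1b-G smallness bridge of seat p38, NOT answered here), the member thresholds (existential, «For M sufficiently large» + «for RM satisfying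
(2.59)»), the (3.37) smallness `α₁(□) ≤ min(a₁, 1∕4)`, `c_f = L^k`, the section `ιB`, `N ≥ 1`, a real basis `b` of `M_N(ℂ)` with coordinate bound `M₂`, the
class-(52) size `α₀′ ≤ a₀` with `C₀α₀′ ≤ ⅓`, `2α₀′ ≤ c₂′`, `pdev (liftCfg U) < α₀′(L^k)⁻²`, a background family through `U` (bookkeeping device).  DESIGN constants
(not printed constants): `δ = min` of FILES 12–14's rates, `K_G, K_D, K_C` theirs; the (2.61) door exponents `exp261 geo9K δ₀ βₓ`, `exp261 geo9K ρ 1` and the row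
constant `c₁(exp261 geo9K ρ 1, ρ, 1)` are the family's definite ones BY CHOICE ([4] prints generic `d`, `c₁`).  Sup-entries only; finite 𝕋 members of the k-level V1
family; count-neutral; no summit ∕ sub-problem statement is proved; nothing continuum ∕ OS ∕ mass-gap ∕ Clay; NOT a node discharge; `stub_PV3A` NOT discharged.
No `sorry`, no `axiom`, no `… : Prop` fact, no `instance`, no `notation`, no `def`.  NEW file; nothing landed is modified.  Cell `lit-balaban`, seat
`lit-balaban-p33` gen 99, 2026-08-28; `--supports stmt-QuantumFields-19200` as helper.  Net new unproved facts: 0.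

RELATED IN THE TREE, NOT DUPLICATED (searched 2026-08-28: `lean search 'knitLetters_of_cubeData|knitMajorants_of_cubeData|KnitMajorantsOfCubeData' --decl` = ∅):
t2s-1's A7 `B8Thm2TorusKnitMajorantsOfSite.knitMajorants_of_site` (the SAME package from M5.6's per-cube data SUPPLIED AT parKnitY with `hD` displayed — a
different input list; superseded inputs, not modified), A8 `B8Thm2TorusKnitMajorantsOfCubes`, A10 `B8Thm2TorusKnitCubeGeometry` (geometry pattern REUSED by name:
`rowSum261_geo9K`, `ineq261_exp261_of_rowSum261`, `triangle254_toB6_iff`), A14 `B8Thm2TorusKnitCubeCore` (the per-cube core route); FILES 12 ∕ 13 ∕ 14 (USED).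
-/

noncomputable section

open scoped BigOperators Matrix Matrix.Norms.L2Operator

namespace Literature.MathematicalPhysics.QuantumFieldTheory.Balaban1983to89.B9KnitMajorantsOfCubeData

open B4PartitionUnity22 (thetaProf D1)
open B9Eq39Adjoint (fluct covD)
open B6Geom246MultiLevelBox (blkOf)
open B6KLevelCensusIndexV1 (KIdx kGeo)
open B6Cover236MultiLevelBlocks (cubes)
open B6GlobalChartV1 (PV boxEquiv)
open B6Ineq2142KLevelV1 (β)
open B6RandomWalk (HasMajorant)
open B9BackgroundsKLevelV1 (shiftsV1)
open B9Eq352DivFormLetters (conj)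
open B9Eq352GradLetters (diffLetter)
open B9Eq360DeltaPrimeAY (AfldY)
open B9CubeGeometryInputs (RM1)
open B9GeoNormsKLevelV1 (geo9K)
open B9GeoLemma21KLevelV1 (geo9K_len_pos rowSum261_geo9K geo9K_dist_triangle geo9K_dist_nonneg')
open B9Thm34Ext (toB6 triangle254_toB6_iff)
open B9RWSums347DefiniteFaces (exp261 ineq261_exp261_of_rowSum261)
open B9Ineq349SiteComposite (etaS_pos)
open B9Cor36CubeCutoffs (SC NearC)
open B9B8KnitLetterXDiffMajorant (hasMajorant_rate_mono)
open B9Thm31GpAtKnitLetterOfCubeData (gp_at_knit_member_of_cubeData_unitary)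
open B9Thm31GradGpAtKnitLetterOfCubeData (gradGp_at_knit_member_of_cubeData_unitary)
open B9Thm32CinvAtKnitLetterOfCubeDataThmD (cinv_at_knit_member_of_cubeData_unitary_thmD)
open B9Thm37GpAtCoverLarge (geo9K_M_eq')
open B8Thm2TorusKnitEstimatesOfMajorants (KnitMajorants)
open B7Prop2Explicit (AvgClosed pdev C0 c2' unitaryUnits)
open B9B8CarrierDictionary (liftCfg)
open B9B8AveragingJunction (parKnitY)
open Node00 (SiteY BlkY CfgY GaugeY IBondY toKT gaugeY GpY XinvY etaS UboxY shiftY)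

variable {d ℓ : ℕ} {hd : 1 ≤ d + 1} {hL : Odd (ℓ + 1) ∧ 1 < ℓ + 1} {b₀ b₁ : ℝ}

section Main

variable {N : ℕ} {G : Subgroup (Matrix (Fin N) (Fin N) ℂ)ˣ}
variable {ι : Type} [Fintype ι] [DecidableEq ι] (b : Module.Basis ι ℝ (Matrix (Fin N) (Fin N) ℂ))

/-! ## §1 ★★★ The three knit letters under one header at one common rate -/

/-- ★★★ **THEOREM 3.1 (3.42)₁, (3.42)₂ AND THEOREM 3.2 (3.48) AT PRINT's KNIT LETTER, AT A `U(N)`-VALUED (3.35)-REGULAR BACKGROUND OF THE CLASS (52), FOR EVERY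
MEMBER ABOVE ONE THRESHOLD, FROM THE PER-CUBE (3.35) DATA — ONE HEADER, ONE RATE** (FILE 12 `gp_at_knit_member_of_cubeData_unitary`, FILE 13
`gradGp_at_knit_member_of_cubeData_unitary`, FILE 14 `cinv_at_knit_member_of_cubeData_unitary_thmD`, each weakened to the common rate by `hasMajorant_rate_mono`):
for `G ≤ U(N)` averaging-closed, `N ≥ 1`, the walk data `(Rr, Hp)` and a real basis `b` of `M_N(ℂ)` with coordinate bound `M₂` there are `δ > 0`, `K_G, K_D, K_C ≥ 0`,
thresholds `M₀, T₀, N₀`, `a₁ > 0` and `a₀ > 0` such that for every `0 < α₀′ ≤ a₀` with `C₀α₀′ ≤ ⅓`, `2α₀′ ≤ c₂′`, every member above the thresholds with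
`c_f = L^k`, every section `ιB`, every `G`-valued `U` with `pdev (liftCfg U) < α₀′(L^k)⁻²`, every family of per-cube (3.35) data (FILES 12–14's eleven hypotheses
verbatim) and every background family through `U`: `conj b(η²G′(U; parKnitY)) ≺ K_G·ℓ(a)²·e^{−δd}` and, for every `μ`, `conj b(η⁻¹∇_μ)·conj b(η²G′(U; parKnitY)) ≺
K_D·ℓ(a)·e^{−δd}` on the site carrier `(x, j) ↦ ιB(block of x)`, and `conj b((η²η²)⁻¹•(Q′G′²Q′*)⁻¹(U; parKnitY)) ≺ K_C·(ℓ(a)⁴)⁻¹·e^{−δd}` on the block carrier.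
DESIGN constants: `δ = min(δ₁₂, δ₁₃, δ₁₄)` of the three files' rates; `K_G, K_D, K_C` theirs (dependence lists in their docstrings).
[cite: Balaban1985BackgroundPropagators, Thm 3.1 (3.42) p.397 + Thm 3.2 (3.48) p.398 + (3.19) p.393 + Thm 3.7 pp.409–410 + Cor. 3.6 p.408 + Thm 3.9 p.413 + p.412 l.1–9 + Thm 3.11 p.416; Balaban1984PropagatorsII, (2.50)–(2.52) p.232 + Lemma 2.1 (2.60)–(2.61) p.234; Balaban1983RegularityDecay, Thm (5.8) p.594; Balaban1985Averaging, (52)–(53) pp.26–27] -/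
theorem knitLetters_of_cubeData_unitary [Nonempty (Fin N)] [∀ i' : KIdx d ℓ hd hL b₀ b₁, Fintype (geo9K i').Site]
    [∀ i' : KIdx d ℓ hd hL b₀ b₁, DecidableEq (geo9K i').Site] (hG : G ≤ unitaryUnits (Matrix (Fin N) (Fin N) ℂ)) (hGa : AvgClosed (d + 1) (ℓ + 1) G)
    (Rr : KIdx d ℓ hd hL b₀ b₁ → ℝ) (Hp : KIdx d ℓ hd hL b₀ b₁ → Prop)
    (hℓ : 1 ≤ ℓ) {M₂ : ℝ} (hM₂ : 0 ≤ M₂) (hrepr : ∀ (v : Matrix (Fin N) (Fin N) ℂ) (j : ι), |b.repr v j| ≤ M₂ * ‖v‖) :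
    ∃ δ KG KD KC M₀ T₀ : ℝ, ∃ N₀ : ℕ, 0 < δ ∧ 0 ≤ KG ∧ 0 ≤ KD ∧ 0 ≤ KC ∧ ∃ a₁ : ℝ, 0 < a₁ ∧ ∃ a₀ : ℝ, 0 < a₀ ∧
    ∀ (α₀' : ℝ), 0 < α₀' → α₀' ≤ a₀ → C0 (d + 1) * α₀' ≤ 1 / 3 → 2 * α₀' ≤ c2' (d + 1) (ℓ + 1) →
    ∀ (i : KIdx d ℓ hd hL b₀ b₁),
      M₀ ≤ ((ℓ : ℝ) + 1) * (toKT i).Mh → N₀ + 1 ≤ (toKT i).R * ((ℓ + 1) * (toKT i).Mh) → T₀ ≤ RM1 i → i.cf = (((ℓ + 1 : ℕ) : ℝ)) ^ i.k →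
    ∀ (ιB : BlkY i → IBondY i), (∀ s, β i.hN i.D i.hk (ιB s) = s) →
    ∀ (U : CfgY (Matrix (Fin N) (Fin N) ℂ) i), (∀ μ x, U μ x ∈ G) → pdev (liftCfg U) < α₀' * ((((ℓ + 1 : ℕ) : ℝ) ^ i.k)⁻¹) ^ 2 →
    ∀ (g : ↥(cubes (toKT i).D.toDomains) → GaugeY (Matrix (Fin N) (Fin N) ℂ) i),
      (∀ c x, ‖(g c x : Matrix (Fin N) (Fin N) ℂ)‖ ≤ 1 ∧ ‖(((g c x)⁻¹ : (Matrix (Fin N) (Fin N) ℂ)ˣ) : Matrix (Fin N) (Fin N) ℂ)‖ ≤ 1) →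
    ∀ (A : ↥(cubes (toKT i).D.toDomains) → AfldY (Matrix (Fin N) (Fin N) ℂ) i)
      (Q : ↥(cubes (toKT i).D.toDomains) → Set (Site (PV d ℓ i.m i.K hd hL) 0)) (C ξ Λ : ↥(cubes (toKT i).D.toDomains) → ℝ),
      (∀ c, 0 ≤ C c) → (∀ c, 0 < ξ c) → (∀ c, 1 ≤ Λ c) → (∀ c, ξ c ≤ 5 * (SC i c : ℝ) * (kGeo i).eta) →
      (∀ c, LatticeNorms.scaleLen ((ℓ : ℝ) + 1) (kGeo i).eta (c.1.1 + 1) ≤ Λ c * ξ c) →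
      (∀ c, ∀ x : Site (PV d ℓ i.m i.K hd hL) 0, NearC i c (35 * SC i c / 8 + 1) (boxEquiv i.hN x).1 → x ∈ Q c) →
      (∀ c, ∀ (κ : Fin (d + 1)) (x : Site (PV d ℓ i.m i.K hd hL) 0), x ∈ Q c → x.shift κ ∈ Q c →
        gaugeY i (g c) U κ x = fluct (kGeo i).eta (A c) κ x) →
      (∀ c, ∀ κ, ∀ x ∈ Q c, ‖A c κ x‖ ≤ C c * (ξ c)⁻¹) →
      (∀ c, ∀ μ ν, ∀ x ∈ Q c,
        ‖(((kGeo i).eta : ℂ)⁻¹) • covD (shiftsV1 (PV d ℓ i.m i.K hd hL)) (fun _ _ => (1 : (Matrix (Fin N) (Fin N) ℂ)ˣ)) μ (A c ν) x‖ ≤ C c * (ξ c ^ 2)⁻¹) →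
      (∀ c, max (C c) (C c * (1 + D1 thetaProf)) * Λ c ^ 2 ≤ a₁) → (∀ c, max (C c) (C c * (1 + D1 thetaProf)) * Λ c ^ 2 ≤ 1 / 4) →
    ∀ {B : B9.Backgrounds} (cfg : B.Cfg → CfgY (Matrix (Fin N) (Fin N) ℂ) i) (U₁ : B.Cfg), cfg U₁ = U →
      HasMajorant (g := toB6 (geo9K i) (Rr i) (Hp i)) (fun p : SiteY i × ι => ιB (blkOf i.D.toDomains p.1))
          (conj b ((etaS i ^ 2) • (GpY i (parKnitY i) U).restrictScalars ℝ))
          (fun a a' => KG * (geo9K i).len a ^ 2 * Real.exp (-(δ * (geo9K i).dist a a'))) ∧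
      (∀ μ : Fin (d + 1), HasMajorant (g := toB6 (geo9K i) (Rr i) (Hp i)) (fun p : SiteY i × ι => ιB (blkOf i.D.toDomains p.1))
          (conj b (diffLetter (shiftY i) (UboxY i U) ((((etaS i : ℝ) : ℂ))⁻¹) (Sum.inl μ)) * conj b ((etaS i ^ 2) • (GpY i (parKnitY i) U).restrictScalars ℝ))
          (fun a a' => KD * (geo9K i).len a * Real.exp (-(δ * (geo9K i).dist a a')))) ∧
      HasMajorant (g := toB6 (geo9K i) (Rr i) (Hp i)) (fun p : BlkY i × ι => ιB p.1)
        (conj b ((etaS i ^ 2 * etaS i ^ 2)⁻¹ • (XinvY i (parKnitY i) (GpY i (parKnitY i)) U).restrictScalars ℝ))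
        (fun a a' => KC * ((geo9K i).len a ^ 4)⁻¹ * Real.exp (-(δ * (geo9K i).dist a a'))) := by
  -- FILE 12 (the `G′`-line), FILE 13 (the gradient line), FILE 14 (the `C`-line, Theorem D discharged)
  obtain ⟨δ₁, K₁, Ma, Ta, Na, hδ₁, hK₁, a₁a, ha₁a, a₀a, ha₀a, H12⟩ := gp_at_knit_member_of_cubeData_unitary b hG hGa Rr Hp hℓ hM₂ hrepr
  obtain ⟨δ₂, K₂, Mb, Tb, Nb, hδ₂, hK₂, a₁b, ha₁b, a₀b, ha₀b, H13⟩ := gradGp_at_knit_member_of_cubeData_unitary b hG hGa Rr Hp hℓ hM₂ hrepr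
  obtain ⟨δ₃, K₃, Mc, Tc, Nc, hδ₃, hK₃, a₁c, ha₁c, a₀c, ha₀c, H14⟩ := cinv_at_knit_member_of_cubeData_unitary_thmD b hG hGa Rr Hp hℓ hM₂ hrepr
  refine ⟨min δ₁ (min δ₂ δ₃), K₁, K₂, K₃, max Ma (max Mb Mc), max Ta (max Tb Tc), max Na (max Nb Nc), lt_min hδ₁ (lt_min hδ₂ hδ₃), hK₁, hK₂, hK₃,
    min a₁a (min a₁b a₁c), lt_min ha₁a (lt_min ha₁b ha₁c), min a₀a (min a₀b a₀c), lt_min ha₀a (lt_min ha₀b ha₀c), ?_⟩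
  intro α₀' hα ha₀' hα3 hα2 i hM hN hT hcf ιB hι U hU h52 g hu A Q C ξ Λ hC0 hξ hΛ hξS hΛξ hQ hgA hA hdA hα₁ hα4 B cfg U₁ hcfg
  -- the sizes and thresholds of the three suppliers
  have ha₀a' : α₀' ≤ a₀a := ha₀'.trans (min_le_left _ _)
  have ha₀b' : α₀' ≤ a₀b := ha₀'.trans ((min_le_right _ _).trans (min_le_left _ _))
  have ha₀c' : α₀' ≤ a₀c := ha₀'.trans ((min_le_right _ _).trans (min_le_right _ _))
  have hMa : Ma ≤ ((ℓ : ℝ) + 1) * (toKT i).Mh := (le_max_left _ _).trans hM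
  have hMb : Mb ≤ ((ℓ : ℝ) + 1) * (toKT i).Mh := ((le_max_left _ _).trans (le_max_right _ _)).trans hM
  have hMc : Mc ≤ ((ℓ : ℝ) + 1) * (toKT i).Mh := ((le_max_right _ _).trans (le_max_right _ _)).trans hM
  have hNa : Na + 1 ≤ (toKT i).R * ((ℓ + 1) * (toKT i).Mh) := (Nat.add_le_add_right (le_max_left _ _) 1).trans hN
  have hNb : Nb + 1 ≤ (toKT i).R * ((ℓ + 1) * (toKT i).Mh) := (Nat.add_le_add_right ((le_max_left _ _).trans (le_max_right _ _)) 1).trans hN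
  have hNc : Nc + 1 ≤ (toKT i).R * ((ℓ + 1) * (toKT i).Mh) := (Nat.add_le_add_right ((le_max_right _ _).trans (le_max_right _ _)) 1).trans hN
  have hTa : Ta ≤ RM1 i := (le_max_left _ _).trans hT
  have hTb : Tb ≤ RM1 i := ((le_max_left _ _).trans (le_max_right _ _)).trans hT
  have hTc : Tc ≤ RM1 i := ((le_max_right _ _).trans (le_max_right _ _)).trans hT
  have hα₁a : ∀ c, max (C c) (C c * (1 + D1 thetaProf)) * Λ c ^ 2 ≤ a₁a := fun c => (hα₁ c).trans (min_le_left _ _)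
  have hα₁b : ∀ c, max (C c) (C c * (1 + D1 thetaProf)) * Λ c ^ 2 ≤ a₁b := fun c => (hα₁ c).trans ((min_le_right _ _).trans (min_le_left _ _))
  have hα₁c : ∀ c, max (C c) (C c * (1 + D1 thetaProf)) * Λ c ^ 2 ≤ a₁c := fun c => (hα₁ c).trans ((min_le_right _ _).trans (min_le_right _ _))
  -- the three letters at their own rates
  have hGm := H12 α₀' hα ha₀a' hα3 hα2 i hMa hNa hTa hcf ιB hι U hU h52 g hu A Q C ξ Λ hC0 hξ hΛ hξS hΛξ hQ hgA hA hdA hα₁a hα4 cfg U₁ hcfg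
  have hDG := H13 α₀' hα ha₀b' hα3 hα2 i hMb hNb hTb hcf ιB hι U hU h52 g hu A Q C ξ Λ hC0 hξ hΛ hξS hΛξ hQ hgA hA hdA hα₁b hα4 cfg U₁ hcfg
  have hC := H14 α₀' hα ha₀c' hα3 hα2 i hMc hNc hTc hcf ιB hι U hU h52 g hu A Q C ξ Λ hC0 hξ hΛ hξS hΛξ hQ hgA hA hdA hα₁c hα4 cfg U₁ hcfg
  -- rate weakening to the common rate `min(δ₁, δ₂, δ₃)`
  have hr₁ : min δ₁ (min δ₂ δ₃) ≤ δ₁ := min_le_left _ _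
  have hr₂ : min δ₁ (min δ₂ δ₃) ≤ δ₂ := (min_le_right _ _).trans (min_le_left _ _)
  have hr₃ : min δ₁ (min δ₂ δ₃) ≤ δ₃ := (min_le_right _ _).trans (min_le_right _ _)
  have hl1 : ∀ a : (geo9K i).Site, 0 ≤ (geo9K i).len a := fun a => (geo9K_len_pos i a).le
  exact ⟨hasMajorant_rate_mono i (Rr := Rr i) (Hp := Hp i) (fun p : SiteY i × ι => ιB (blkOf i.D.toDomains p.1)) (fun a => (geo9K i).len a ^ 2) hK₁
      (fun a => sq_nonneg _) hr₁ hGm,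
    fun μ => hasMajorant_rate_mono i (Rr := Rr i) (Hp := Hp i) (fun p : SiteY i × ι => ιB (blkOf i.D.toDomains p.1)) (fun a => (geo9K i).len a) hK₂ hl1 hr₂ (hDG μ),
    hasMajorant_rate_mono i (Rr := Rr i) (Hp := Hp i) (fun p : BlkY i × ι => ιB p.1) (fun a => ((geo9K i).len a ^ 4)⁻¹) hK₃
      (fun a => inv_nonneg.2 (pow_nonneg (hl1 a) 4)) hr₃ hC⟩

/-! ## §2 ★★★ The [B8] Thm 2 torus assembler's `KnitMajorants`, inhabited from the cube data -/

/-- ★★★ **THE [B8] THM 2 TORUS ASSEMBLER's MAJORANT PACKAGE `KnitMajorants`, INHABITED FOR EVERY MEMBER ABOVE ONE THRESHOLD AND EVERY `U(N)`-VALUED BACKGROUND OF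
THE CLASS (52) CARRYING PER-CUBE (3.35) DATA** (§1 + the member's [4] §2 geometry from the tree): for `G ≤ U(N)` averaging-closed, `N ≥ 1`, the walk data
`(Rr, Hp)` and a real basis `b` of `M_N(ℂ)` with coordinate bound `M₂` there are `δ > 0`, `K_G, K_D, K_C ≥ 0`, `a₁ > 0`, `a₀ > 0` such that for every resummation
triple `(δ₀, βₓ, ρ)` with `βₓδ₀ > 0`, `ρ > 0` there are thresholds `M₀, T₀, N₀` such that for every `0 < α₀′ ≤ a₀` with `C₀α₀′ ≤ ⅓`, `2α₀′ ≤ c₂′`, every member `i`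
above the thresholds with `c_f = L^k`, every section `ιB`, every `G`-valued `U` with `pdev (liftCfg U) < α₀′(L^k)⁻²`, every family of per-cube (3.35) data and every
background family through `U`:
`KnitMajorants i U b ιB (Rr i) (Hp i) (exp261 geo9K δ₀ βₓ) δ₀ δ βₓ ρ K_G K_D K_C (c₁(exp261 geo9K ρ 1, ρ, 1)) (η_S²η_S²)⁻¹` — i.e. `ιB` a section, `c_f = L^k`,
`η_S⁴·s = 1`, `d ≥ 0`, (2.54), (2.61) at `(δ₀, βₓ)` with the family's door exponent, the row sum `Σ_{a′} e^{−ρd(a,a′)} ≤ c₁(exp261 geo9K ρ 1, ρ, 1)`, and the three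
letters of §1.  The consumer (`knitEstimates_of_majorants` ∕ `thm2TorusAt_specialUnitary_ofMajorants`) chooses `(δ₀, βₓ, ρ)` with `ρ + 2βₓδ₀ ≤ δ` AFTER `δ`.
[cite: Balaban1985BackgroundPropagators, Thm 3.1 (3.42) p.397 + Thm 3.2 (3.48) p.398 + (3.19) p.393 + Thm 3.7 pp.409–410 + Thm 3.9 p.413; Balaban1984PropagatorsII, (2.54) p.233 + Lemma 2.1 (2.59)–(2.61) pp.233–234; Balaban1985RegularSpaces, (1.91)–(1.98) pp.91–92 + Thm 2 p.83; Balaban1985Averaging, (52)–(53) pp.26–27] -/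
theorem knitMajorants_of_cubeData_unitary [Nonempty (Fin N)] [∀ i' : KIdx d ℓ hd hL b₀ b₁, Fintype (geo9K i').Site]
    [∀ i' : KIdx d ℓ hd hL b₀ b₁, DecidableEq (geo9K i').Site] (hG : G ≤ unitaryUnits (Matrix (Fin N) (Fin N) ℂ)) (hGa : AvgClosed (d + 1) (ℓ + 1) G)
    (Rr : KIdx d ℓ hd hL b₀ b₁ → ℝ) (Hp : KIdx d ℓ hd hL b₀ b₁ → Prop)
    (hℓ : 1 ≤ ℓ) {M₂ : ℝ} (hM₂ : 0 ≤ M₂) (hrepr : ∀ (v : Matrix (Fin N) (Fin N) ℂ) (j : ι), |b.repr v j| ≤ M₂ * ‖v‖) :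
    ∃ δ KG KD KC : ℝ, 0 < δ ∧ 0 ≤ KG ∧ 0 ≤ KD ∧ 0 ≤ KC ∧ ∃ a₁ : ℝ, 0 < a₁ ∧ ∃ a₀ : ℝ, 0 < a₀ ∧
    ∀ (δ₀ βx ρ : ℝ), 0 < βx * δ₀ → 0 < ρ → ∃ M₀ T₀ : ℝ, ∃ N₀ : ℕ,
    ∀ (α₀' : ℝ), 0 < α₀' → α₀' ≤ a₀ → C0 (d + 1) * α₀' ≤ 1 / 3 → 2 * α₀' ≤ c2' (d + 1) (ℓ + 1) →
    ∀ (i : KIdx d ℓ hd hL b₀ b₁),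
      M₀ ≤ ((ℓ : ℝ) + 1) * (toKT i).Mh → N₀ + 1 ≤ (toKT i).R * ((ℓ + 1) * (toKT i).Mh) → T₀ ≤ RM1 i → i.cf = (((ℓ + 1 : ℕ) : ℝ)) ^ i.k →
    ∀ (ιB : BlkY i → IBondY i), (∀ s, β i.hN i.D i.hk (ιB s) = s) →
    ∀ (U : CfgY (Matrix (Fin N) (Fin N) ℂ) i), (∀ μ x, U μ x ∈ G) → pdev (liftCfg U) < α₀' * ((((ℓ + 1 : ℕ) : ℝ) ^ i.k)⁻¹) ^ 2 →
    ∀ (g : ↥(cubes (toKT i).D.toDomains) → GaugeY (Matrix (Fin N) (Fin N) ℂ) i),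
      (∀ c x, ‖(g c x : Matrix (Fin N) (Fin N) ℂ)‖ ≤ 1 ∧ ‖(((g c x)⁻¹ : (Matrix (Fin N) (Fin N) ℂ)ˣ) : Matrix (Fin N) (Fin N) ℂ)‖ ≤ 1) →
    ∀ (A : ↥(cubes (toKT i).D.toDomains) → AfldY (Matrix (Fin N) (Fin N) ℂ) i)
      (Q : ↥(cubes (toKT i).D.toDomains) → Set (Site (PV d ℓ i.m i.K hd hL) 0)) (C ξ Λ : ↥(cubes (toKT i).D.toDomains) → ℝ),
      (∀ c, 0 ≤ C c) → (∀ c, 0 < ξ c) → (∀ c, 1 ≤ Λ c) → (∀ c, ξ c ≤ 5 * (SC i c : ℝ) * (kGeo i).eta) →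
      (∀ c, LatticeNorms.scaleLen ((ℓ : ℝ) + 1) (kGeo i).eta (c.1.1 + 1) ≤ Λ c * ξ c) →
      (∀ c, ∀ x : Site (PV d ℓ i.m i.K hd hL) 0, NearC i c (35 * SC i c / 8 + 1) (boxEquiv i.hN x).1 → x ∈ Q c) →
      (∀ c, ∀ (κ : Fin (d + 1)) (x : Site (PV d ℓ i.m i.K hd hL) 0), x ∈ Q c → x.shift κ ∈ Q c →
        gaugeY i (g c) U κ x = fluct (kGeo i).eta (A c) κ x) →
      (∀ c, ∀ κ, ∀ x ∈ Q c, ‖A c κ x‖ ≤ C c * (ξ c)⁻¹) →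
      (∀ c, ∀ μ ν, ∀ x ∈ Q c,
        ‖(((kGeo i).eta : ℂ)⁻¹) • covD (shiftsV1 (PV d ℓ i.m i.K hd hL)) (fun _ _ => (1 : (Matrix (Fin N) (Fin N) ℂ)ˣ)) μ (A c ν) x‖ ≤ C c * (ξ c ^ 2)⁻¹) →
      (∀ c, max (C c) (C c * (1 + D1 thetaProf)) * Λ c ^ 2 ≤ a₁) → (∀ c, max (C c) (C c * (1 + D1 thetaProf)) * Λ c ^ 2 ≤ 1 / 4) →
    ∀ {B : B9.Backgrounds} (cfg : B.Cfg → CfgY (Matrix (Fin N) (Fin N) ℂ) i) (U₁ : B.Cfg), cfg U₁ = U →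
      KnitMajorants i U b ιB (Rr i) (Hp i) (exp261 (geo9K (d := d) (ℓ := ℓ) (hd := hd) (hL := hL) (b₀ := b₀) (b₁ := b₁)) δ₀ βx) δ₀ δ βx ρ KG KD KC
        (B6.c1 (exp261 (geo9K (d := d) (ℓ := ℓ) (hd := hd) (hL := hL) (b₀ := b₀) (b₁ := b₁)) ρ 1) ρ 1) (etaS i ^ 2 * etaS i ^ 2)⁻¹ := by
  obtain ⟨δ, KG, KD, KC, M₀, T₀, N₀, hδ, hKG, hKD, hKC, a₁, ha₁, a₀, ha₀, H⟩ := knitLetters_of_cubeData_unitary b hG hGa Rr Hp hℓ hM₂ hrepr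
  refine ⟨δ, KG, KD, KC, hδ, hKG, hKD, hKC, a₁, ha₁, a₀, ha₀, fun δ₀ βx ρ hβδ hρ => ?_⟩
  -- the member geometry: (2.61) at `(δ₀, βₓ)` and the row sum at `ρ` through the family's door exponents, above one threshold each
  obtain ⟨ML₁, h261⟩ := ineq261_exp261_of_rowSum261 (geo := geo9K (d := d) (ℓ := ℓ) (hd := hd) (hL := hL) (b₀ := b₀) (b₁ := b₁)) Rr Hp hβδ
    (rowSum261_geo9K (d := d) (ℓ := ℓ) (hd := hd) (hL := hL) (b₀ := b₀) (b₁ := b₁))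
  have hρ1 : 0 < 1 * ρ := by rwa [one_mul]
  obtain ⟨ML₂, hrow⟩ := ineq261_exp261_of_rowSum261 (geo := geo9K (d := d) (ℓ := ℓ) (hd := hd) (hL := hL) (b₀ := b₀) (b₁ := b₁)) Rr Hp hρ1
    (rowSum261_geo9K (d := d) (ℓ := ℓ) (hd := hd) (hL := hL) (b₀ := b₀) (b₁ := b₁))
  refine ⟨max M₀ (max ML₁ ML₂), T₀, N₀, ?_⟩
  intro α₀' hα ha₀' hα3 hα2 i hM hN hT hcf ιB hι U hU h52 g hu A Q C ξ Λ hC0 hξ hΛ hξS hΛξ hQ hgA hA hdA hα₁ hα4 B cfg U₁ hcfg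
  have hM₀ : M₀ ≤ ((ℓ : ℝ) + 1) * (toKT i).Mh := (le_max_left _ _).trans hM
  have hML₁ : ML₁ ≤ (geo9K i).M := by
    rw [geo9K_M_eq' i]; exact ((le_max_left _ _).trans (le_max_right _ _)).trans hM
  have hML₂ : ML₂ ≤ (geo9K i).M := by
    rw [geo9K_M_eq' i]; exact ((le_max_right _ _).trans (le_max_right _ _)).trans hM
  obtain ⟨hGm, hDG, hC⟩ := H α₀' hα ha₀' hα3 hα2 i hM₀ hN hT hcf ιB hι U hU h52 g hu A Q C ξ Λ hC0 hξ hΛ hξS hΛξ hQ hgA hA hdA hα₁ hα4 cfg U₁ hcfg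
  exact
  { hι := hι
    hcf := hcf
    hs := mul_inv_cancel₀ (mul_pos (pow_pos (etaS_pos i) 2) (pow_pos (etaS_pos i) 2)).ne'
    hdnn := geo9K_dist_nonneg' i
    htri := (triangle254_toB6_iff (geo9K i) (Rr i) (Hp i)).2 (geo9K_dist_triangle i)
    h261 := h261 i hML₁
    hrow := fun a =>
      calc ∑ a' : (geo9K i).Site, Real.exp (-(ρ * (geo9K i).dist a a'))
          = ∑ a' : (geo9K i).Site, Real.exp (-(1 * ρ * (toB6 (geo9K i) (Rr i) (Hp i)).dist a a')) :=
            Finset.sum_congr rfl fun a' _ => by rw [one_mul]; rfl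
        _ ≤ B6.c1 (exp261 (geo9K (d := d) (ℓ := ℓ) (hd := hd) (hL := hL) (b₀ := b₀) (b₁ := b₁)) ρ 1) ρ 1 := hrow i hML₂ a
    hGm := hGm
    hDG := hDG
    hC := hC }

end Main

end Literature.MathematicalPhysics.QuantumFieldTheory.Balaban1983to89.B9KnitMajorantsOfCubeData

end
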